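import Literature.AlgebraicGeometry.Motives.AbelianVarietyLatticeTensor
import HarnessLib

/-!
# Geometric points and torsion of a lattice tensor: `(Y ⊗_β M)(K̄) ≅ M ⊗ Y(K̄)` and `(Y ⊗_β M)[n] ≅ M ⊗ Y[n]`,
# `Γ_K`-equivariantly and with `g` acting by `m(g) ⊗ β(g)` (Mazur–Rubin–Silverberg Thm. 2.2 (i), (ii))

Sequel of `Motives/AbelianVarietyLatticeTensor` and the companion of `Motives/AbelianVarietyLatticeTensorCoordinates` §2 (the `ℓ`-adic
statement, Thm. 2.2 (iii)).  For a lattice tensor `X = Y ⊗_β M` (bicone `b` over `(Y)_{i ∈ ι}` with `Σ π_i ι_i = 𝟙`, action `ρ` with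
`ι_j ρ(g) π_i = m(g)_{ij} • β(g)`) and the geometric-points functor `A ↦ A(K̄)` (`geomPoints`, `geomPointsMap`; additive and functorial,
Mumford §4, §19), proved here (no definitions):

* §1 **MRS Thm. 2.2 (i): `(Y ⊗ M)(K̄) ≅ M ⊗ Y(K̄)`** — there is an additive isomorphism **`e : X(K̄) ≃+ (ι → Y(K̄))`, `e(x)_i = π_i(x)`,
  `e⁻¹(v) = Σ_i ι_i(v_i)`** (`exists_addEquiv_geomPoints`), and ANY such coordinate map is **`Γ_K`-equivariant, `e(σ x) = σ e(x)`**
  (`geomPoints_coord_smul`, the `π_i` are defined over `K`) and intertwines `ρ(g)` with the Kronecker action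
  **`e(ρ(g) x)_i = Σ_j m(g)_{ij} • β(g)(e(x)_j)`** (`geomPoints_coord_asHom_eq_sum`; untwisted `e(ρ(g) x)_i = Σ_j m(g)_{ij} • e(x)_j`);
* §2 **MRS Thm. 2.2 (ii): `(Y ⊗ M)[n] ≅ M ⊗ Y[n]`** — `x ∈ X[n] ⟺ e(x)_i ∈ Y[n]` for all `i` (`mem_geomTorsion_iff_coord`), and the
  restricted additive isomorphism **`e_n : X[n] ≃+ (ι → Y[n])` with `e_n(x)_i = π_i(x)`** exists (`exists_addEquiv_geomTorsion`),
  again `Γ_K`-equivariant and with `e_n(ρ(g) x)_i = Σ_j m(g)_{ij} • β(g)(e_n(x)_j)` on underlying points (from §1).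

## References

* [MazurRubinSilverberg2007] B. Mazur, K. Rubin, A. Silverberg, *Twisting commutative algebraic groups*, J. Algebra 314 (2007)
  419–438, Thm. 2.2: "(i) `(I ⊗_𝒪 V)(k^s) ≅ I ⊗_𝒪 (V(k^s))`, (ii) `(I ⊗_𝒪 V)[n] ≅ I ⊗_𝒪 (V[n])` … `G_k`-equivariant isomorphisms,
  functorial in `I` and `V`" (proof: Lemma 1.3; "since `I` is a free `𝒪`-module, `(I ⊗ V(k^s))[n] ≅ I ⊗ V[n]`").  Held:
  `paper:doi-10-1016-j-jalgebra-2007-02-052`, PDF p. 6 read 2026-08-28.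
* [Milne1972ArithmeticAV] J. S. Milne, *On the arithmetic of abelian varieties*, Invent. Math. 17 (1972), §2 Prop. 6 (b), as reported
  by [MazurRubinSilverberg2007].
* [SerreTate1968] J.-P. Serre, J. Tate, *Good reduction of abelian varieties*, Ann. of Math. 88 (1968), §1 (`A[n]` as a `Γ_K`-module).
* [MumfordAV1970] D. Mumford, *Abelian Varieties* (1970), §4 (points, p. 40), §6 (`A[n]`, p. 64), §19 (p. 173: homomorphisms of
  products; additivity).
-/

noncomputable section

open CategoryTheory CategoryTheory.Limits
open Literature.NumberTheory.DiophantineGeometry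
open Literature.RepresentationTheory.FiniteGroups
open Literature.AlgebraicGeometry.Motives.AbelianVariety.Hom

universe u

namespace Literature.AlgebraicGeometry.Motives

namespace AbelianVariety

namespace LatticeTensor

variable {K : Type u} [Field K] {Y : AbelianVariety K} {ι : Type} [Fintype ι] [DecidableEq ι] (b : Bicone (fun _ : ι ↦ Y))
  {G : Type} [Group G] (m : G →* Matrix ι ι ℤ) (β : G →* End Y) (ρ : G →* End b.pt)

/-! ## §1 `(Y ⊗_β M)(K̄) ≅ M ⊗ Y(K̄)` (MRS Thm. 2.2 (i)) -/

omit [Fintype ι] [DecidableEq ι] in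
/-- `π_i(ι_i(P)) = P` on geometric points (`ι_i ≫ π_i = 𝟙`). [cite: MumfordAV1970, §19 (p. 173)] -/
theorem geomPointsMap_π_geomPointsMap_ι_self (i : ι) (P : Y.geomPoints) :
    geomPointsMap (b.π i) (geomPointsMap (b.ι i) P) = P := by
  rw [← AddMonoidHom.comp_apply, ← geomPointsMap_comp, bicone_ι_π_self, geomPointsMap_id, AddMonoidHom.id_apply]

omit [Fintype ι] [DecidableEq ι] in
/-- `π_i(ι_j(P)) = 0` on geometric points for `j ≠ i` (`ι_j ≫ π_i = 0`). [cite: MumfordAV1970, §19 (p. 173)] -/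
theorem geomPointsMap_π_geomPointsMap_ι_ne {i j : ι} (h : j ≠ i) (P : Y.geomPoints) :
    geomPointsMap (b.π i) (geomPointsMap (b.ι j) P) = 0 := by
  rw [← AddMonoidHom.comp_apply, ← geomPointsMap_comp, bicone_ι_π_ne b h, geomPointsMap_zero, AddMonoidHom.zero_apply]

omit [DecidableEq ι] in
/-- `Σ_i ι_i(π_i(x)) = x` on `(Y ⊗ M)(K̄)` (`Σ π_i ι_i = 𝟙`, additivity of `f ↦ f(x)`). [cite: MumfordAV1970, §19 (p. 173)] -/
theorem sum_geomPointsMap_ι_geomPointsMap_π (hb : ∑ j, b.π j ≫ b.ι j = 𝟙 b.pt) (x : b.pt.geomPoints) :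
    ∑ i, geomPointsMap (b.ι i) (geomPointsMap (b.π i) x) = x := by
  have h : geomPointsMap (∑ i, b.π i ≫ b.ι i) = AddMonoidHom.id b.pt.geomPoints := by rw [hb, geomPointsMap_id]
  rw [← geomPointsMapAddMonoidHom_apply, map_sum] at h
  simpa only [geomPointsMapAddMonoidHom_apply, geomPointsMap_comp, AddMonoidHom.finsetSum_apply, AddMonoidHom.comp_apply,
    AddMonoidHom.id_apply] using DFunLike.congr_fun h x

omit [DecidableEq ι] in
/-- **MRS Thm. 2.2 (i): `(Y ⊗ M)(K̄) ≅ M ⊗_ℤ Y(K̄)`.**  There is an additive isomorphism **`e : (Y^ι)(K̄) ≃+ (ι → Y(K̄))` with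
`e(x)_i = π_i(x)` and `e⁻¹(v) = Σ_i ι_i(v_i)`** (the points functor is additive, Mumford §19; "`(I ⊗_𝒪 V)(k^s) ≅ I ⊗_𝒪 V(k^s)`").
[cite: MazurRubinSilverberg2007, Thm. 2.2 (i)] [cite: MumfordAV1970, §4 (p. 40) and §19 (p. 173)] -/
theorem exists_addEquiv_geomPoints (hb : ∑ j, b.π j ≫ b.ι j = 𝟙 b.pt) :
    ∃ e : b.pt.geomPoints ≃+ (ι → Y.geomPoints),
      (∀ x i, e x i = geomPointsMap (b.π i) x) ∧ ∀ v, e.symm v = ∑ i, geomPointsMap (b.ι i) (v i) := by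
  refine ⟨{ toFun := fun x i ↦ geomPointsMap (b.π i) x
            invFun := fun v ↦ ∑ i, geomPointsMap (b.ι i) (v i)
            left_inv := fun x ↦ sum_geomPointsMap_ι_geomPointsMap_π b hb x
            right_inv := fun v ↦ funext fun i ↦ ?_
            map_add' := fun x x' ↦ funext fun i ↦ map_add _ _ _ }, fun x i ↦ rfl, fun v ↦ rfl⟩
  show geomPointsMap (b.π i) (∑ j, geomPointsMap (b.ι j) (v j)) = v i
  rw [map_sum, Finset.sum_eq_single i]
  · exact geomPointsMap_π_geomPointsMap_ι_self b i (v i)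
  · intro j _ hji
    exact geomPointsMap_π_geomPointsMap_ι_ne b hji (v j)
  · intro h
    exact absurd (Finset.mem_univ i) h

omit [Fintype ι] [DecidableEq ι] in
/-- **The coordinate isomorphism is `Γ_K`-equivariant**: `e(σ • x)_i = σ • e(x)_i` for ANY coordinate map with `e(x)_i = π_i(x)` (the
projections are defined over `K`; `Γ_K` acts on `M ⊗ Y(K̄)` through the second factor — "`γ⁻¹ ⊗ γ`" with `G_k` acting trivially on the
split lattice `M`). [cite: MazurRubinSilverberg2007, Thm. 2.2] [cite: SerreTate1968, §1] [cite: MumfordAV1970, §4 (p. 40)] -/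
theorem geomPoints_coord_smul {e : b.pt.geomPoints → ι → Y.geomPoints} (he : ∀ x i, e x i = geomPointsMap (b.π i) x)
    (σ : Field.absoluteGaloisGroup K) (x : b.pt.geomPoints) (i : ι) :
    e (σ • x) i = σ • e x i := by
  rw [he, he, geomPointsMap_smul]

/-- **`(Y ⊗_β M)(K̄) ≅ M ⊗ Y(K̄)` intertwines `ρ(g)` with `m(g) ⊗ β(g)`**: for ANY coordinate map with `e(x)_i = π_i(x)`,
**`e(ρ(g) x)_i = Σ_j m(g)_{ij} • β(g)(e(x)_j)`** (`ρ(g) ≫ π_i = Σ_j m(g)_{ij} • π_j ≫ β(g)` and additivity of the points functor).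
[cite: MazurRubinSilverberg2007, Thm. 2.2 (i) and Def. 1.1] [cite: MumfordAV1970, §19 (p. 173)] -/
theorem geomPoints_coord_asHom_eq_sum (hb : ∑ j, b.π j ≫ b.ι j = 𝟙 b.pt)
    (hρ : ∀ (g : G) (i j : ι), b.ι j ≫ End.asHom (ρ g) ≫ b.π i = m g i j • End.asHom (β g))
    {e : b.pt.geomPoints → ι → Y.geomPoints} (he : ∀ x i, e x i = geomPointsMap (b.π i) x) (g : G)
    (x : b.pt.geomPoints) (i : ι) :
    e (geomPointsMap (End.asHom (ρ g)) x) i = ∑ j, m g i j • geomPointsMap (End.asHom (β g)) (e x j) := by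
  rw [he, ← AddMonoidHom.comp_apply, ← geomPointsMap_comp, asHom_comp_π_eq_sum b m β ρ hb hρ g i,
    ← geomPointsMapAddMonoidHom_apply, map_sum, AddMonoidHom.finsetSum_apply]
  refine Finset.sum_congr rfl fun j _ ↦ ?_
  rw [map_zsmul, he x j, ← AddMonoidHom.comp_apply, ← geomPointsMap_comp]
  rfl

/-- Untwisted case `β = 1`: **`e(ρ(g) x)_i = Σ_j m(g)_{ij} • e(x)_j`** — `(Y ⊗ M)(K̄) ≅ M ⊗ Y(K̄)` with `G` acting through `M`.
[cite: MazurRubinSilverberg2007, Thm. 2.2 (i)] [cite: MumfordAV1970, §19 (p. 173)] -/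
theorem geomPoints_coord_asHom_eq_sum_of_one (hb : ∑ j, b.π j ≫ b.ι j = 𝟙 b.pt)
    (hρ₁ : ∀ (g : G) (i j : ι), b.ι j ≫ End.asHom (ρ g) ≫ b.π i = m g i j • 𝟙 Y)
    {e : b.pt.geomPoints → ι → Y.geomPoints} (he : ∀ x i, e x i = geomPointsMap (b.π i) x) (g : G)
    (x : b.pt.geomPoints) (i : ι) :
    e (geomPointsMap (End.asHom (ρ g)) x) i = ∑ j, m g i j • e x j := by
  have h := geomPoints_coord_asHom_eq_sum b m 1 ρ hb (fun g i j ↦ by rw [hρ₁ g i j]; rfl) he g x i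
  simpa only [MonoidHom.one_apply, show End.asHom (1 : End Y) = 𝟙 Y from rfl, geomPointsMap_id, AddMonoidHom.id_apply] using h

/-! ## §2 `(Y ⊗_β M)[n] ≅ M ⊗ Y[n]` (MRS Thm. 2.2 (ii)) -/

omit [Fintype ι] [DecidableEq ι] in
/-- **`x ∈ (Y ⊗ M)[n] ⟺ π_i(x) ∈ Y[n]` for all `i`**, for any additive coordinate isomorphism `e : X(K̄) ≃+ (ι → Y(K̄))`
("since `I` is a free `𝒪`-module, `(I ⊗ V(k^s))[n] ≅ I ⊗ V[n]`"). [cite: MazurRubinSilverberg2007, Thm. 2.2 (ii) (proof)] [cite: MumfordAV1970, §6 (p. 64)] -/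
theorem mem_geomTorsion_iff_coord (e : b.pt.geomPoints ≃+ (ι → Y.geomPoints)) (n : ℤ) (x : b.pt.geomPoints) :
    x ∈ b.pt.geomTorsion n ↔ ∀ i, e x i ∈ Y.geomTorsion n := by
  rw [mem_geomTorsion_iff', ← e.map_eq_zero_iff, map_zsmul, funext_iff]
  simp only [Pi.smul_apply, Pi.zero_apply, mem_geomTorsion_iff']

omit [DecidableEq ι] in
/-- **MRS Thm. 2.2 (ii): `(Y ⊗ M)[n] ≅ M ⊗_ℤ Y[n]`.**  There is an additive isomorphism **`e_n : (Y^ι)[n] ≃+ (ι → Y[n])` with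
`e_n(x)_i = π_i(x)` and `e_n⁻¹(v) = Σ_i ι_i(v_i)`** on underlying points — the restriction of `(Y ⊗ M)(K̄) ≅ M ⊗ Y(K̄)` (Thm. 2.2 (i)) to
`n`-torsion ("`(ii)` follows from `(i)`"). [cite: MazurRubinSilverberg2007, Thm. 2.2 (ii)] [cite: MumfordAV1970, §6 (p. 64) and §19 (p. 173)] -/
theorem exists_addEquiv_geomTorsion (hb : ∑ j, b.π j ≫ b.ι j = 𝟙 b.pt) (n : ℤ) :
    ∃ eN : b.pt.geomTorsion n ≃+ (ι → Y.geomTorsion n),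
      (∀ x i, (eN x i : Y.geomPoints) = geomPointsMap (b.π i) x) ∧
      ∀ v, (eN.symm v : b.pt.geomPoints) = ∑ i, geomPointsMap (b.ι i) (v i : Y.geomPoints) := by
  -- homomorphisms commute with `[n]` (the tree's `Hom.geomPointsMap_mem_geomTorsion`, not in the import closure; Mumford §6)
  have hmem : ∀ {A B : AbelianVariety K} (f : A ⟶ B) {x : A.geomPoints}, x ∈ A.geomTorsion n → geomPointsMap f x ∈ B.geomTorsion n :=
    fun f x hx ↦ by
      rw [mem_geomTorsion_iff'] at hx ⊢
      rw [← map_zsmul, hx, map_zero]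
  refine ⟨{ toFun := fun x i ↦ ⟨geomPointsMap (b.π i) x, hmem (b.π i) x.2⟩
            invFun := fun v ↦ ⟨∑ i, geomPointsMap (b.ι i) (v i : Y.geomPoints), sum_mem fun i _ ↦ hmem (b.ι i) (v i).2⟩
            left_inv := fun x ↦ Subtype.ext (sum_geomPointsMap_ι_geomPointsMap_π b hb x)
            right_inv := fun v ↦ funext fun i ↦ Subtype.ext ?_
            map_add' := fun x x' ↦ funext fun i ↦ Subtype.ext (map_add (geomPointsMap (b.π i)) (x : b.pt.geomPoints) x') },
    fun x i ↦ rfl, fun v ↦ rfl⟩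
  show geomPointsMap (b.π i) (∑ j, geomPointsMap (b.ι j) (v j : Y.geomPoints)) = v i
  rw [map_sum, Finset.sum_eq_single i]
  · exact geomPointsMap_π_geomPointsMap_ι_self b i (v i)
  · intro j _ hji
    exact geomPointsMap_π_geomPointsMap_ι_ne b hji (v j)
  · intro h
    exact absurd (Finset.mem_univ i) h

omit [Fintype ι] [DecidableEq ι] in
/-- **`(Y ⊗ M)[n] ≅ M ⊗ Y[n]` is `Γ_K`-equivariant**: `e_n(σ • x)_i = σ • e_n(x)_i` for any coordinate map on `n`-torsion with
`e_n(x)_i = π_i(x)` on points. [cite: MazurRubinSilverberg2007, Thm. 2.2 (ii)] [cite: SerreTate1968, §1] -/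
theorem geomTorsion_coord_smul {n : ℤ} {eN : b.pt.geomTorsion n → ι → Y.geomTorsion n}
    (heN : ∀ x i, (eN x i : Y.geomPoints) = geomPointsMap (b.π i) x) (σ : Field.absoluteGaloisGroup K)
    (x : b.pt.geomTorsion n) (i : ι) :
    eN (σ • x) i = σ • eN x i := by
  refine Subtype.ext ?_
  rw [heN, Literature.NumberTheory.EllipticCurves.AddSubgroup.torsionBy.coe_smul,
    Literature.NumberTheory.EllipticCurves.AddSubgroup.torsionBy.coe_smul, heN, geomPointsMap_smul]

/-- **`(Y ⊗_β M)[n] ≅ M ⊗ Y[n]` intertwines `ρ(g)` with `m(g) ⊗ β(g)` (mod `n`)**: on `n`-torsion points,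
**`π_i(ρ(g) x) = Σ_j m(g)_{ij} • β(g)(e_n(x)_j)`** for any coordinate map on `n`-torsion with `e_n(x)_i = π_i(x)`.
[cite: MazurRubinSilverberg2007, Thm. 2.2 (ii) and Def. 1.1] [cite: MumfordAV1970, §19 (p. 173)] -/
theorem geomTorsion_coord_asHom_eq_sum (hb : ∑ j, b.π j ≫ b.ι j = 𝟙 b.pt)
    (hρ : ∀ (g : G) (i j : ι), b.ι j ≫ End.asHom (ρ g) ≫ b.π i = m g i j • End.asHom (β g))
    {n : ℤ} {eN : b.pt.geomTorsion n → ι → Y.geomTorsion n} (heN : ∀ x i, (eN x i : Y.geomPoints) = geomPointsMap (b.π i) x)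
    (g : G) (x : b.pt.geomTorsion n) (i : ι) :
    geomPointsMap (b.π i) (geomPointsMap (End.asHom (ρ g)) x) =
      ∑ j, m g i j • geomPointsMap (End.asHom (β g)) (eN x j : Y.geomPoints) := by
  have h := geomPoints_coord_asHom_eq_sum b m β ρ hb hρ (e := fun x i ↦ geomPointsMap (b.π i) x) (fun _ _ ↦ rfl) g x i
  simpa only [← heN] using h

end LatticeTensor

end AbelianVariety

end Literature.AlgebraicGeometry.Motives
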